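import Literature.AlgebraicGeometry.Resolution.WeightedCentreTruncatedFlow
import Literature.AlgebraicGeometry.Resolution.WeightedCentreGradedPureVectors
import HarnessLib

/-!
# Weight-bounded flows: the exact one-parameter group `τ ↦ Ψ_τ` (engine 1's `W(f)` toy model, target T102 reduced to
# (Φ1)+(Φ2) — an instrument, NOT a resolution theorem)

`WeightedCentreTruncatedFlow` makes `τ ↦ Ψ_τ := (σ ↦ τ) ∘ exp_{<p}(σD)` a one-parameter group of substitutions of `A[σ]`
(`A = R[ε]`) MODULO `σ^p`, for every derivation `D`.  Here is the regime in which the group law is EXACT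
(RE-DERIVATION-eng1-g44 §3.2 (L3) = [R43] 3.3 (Φ1)/(Φ2); CARVER-NOTES-eng1-g44 §2 "T102-REDUCED"): grade `A = R[ε]` by
NONNEGATIVE weights `w` in a linearly ordered group, let `D` be homogeneous of degree `-θ` (`θ ≥ 0`), and call a homogeneous
`g` of weight `m` LIGHT if `m < p•θ`.  Then

* `iterate_eq_zero_of_weight_lt`, `coeff_sigmaExp_eq_zero_of_weight_lt`: `D^[n] g = 0` and `coeff σ^n (T g) = 0` as soon as
  `m < n•θ` — a homogeneous polynomial of negative weight vanishes (`eq_zero_of_isWeightedHomogeneous_of_neg`); this is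
  the WEIGHT BOUND that replaces any nilpotency hypothesis;
* `flowC_eq_sum_of_weight_lt`: for light `g` and EVERY parameter `τ ∈ R[σ]`, `Ψ_τ g = Σ_{n<p} u_n D^n g ⟪τ⟫^n` exactly;
* `flow_flowC_eq_of_weight_lt` (**(Φ1), core**): for light `g`, `Ψ_{τ₁} (Ψ_{τ₂} g) = Ψ_{τ₁+τ₂} g` EXACTLY (the proof of the
  truncated group law with the two error terms now zero: `D^{j+k} g = 0` for `j + k ≥ p` and no `σ^{≥p}`-carries of `T (D^k g)`);
* `flow_comp_flow` (**(Φ1)**): if every generator `ε_i` is light or `D`-constant (`w i < p•θ ∨ D ε_i = 0` — the fixed slots `V`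
  may be heavy), then `Ψ_{τ₁} ∘ Ψ_{τ₂} = Ψ_{τ₁+τ₂}` as ring endomorphisms of `A[σ]`, `Ψ_0 = id`, so `Ψ_τ` is a ring AUTOMORPHISM
  `flowEquiv τ` with inverse `Ψ_{-τ}`, `τ ↦ flowEquiv τ` is a homomorphism `flowHom : R[σ] → Aut A[σ]`
  (`flowEquiv_add`, `flowEquiv_nsmul`, `flowEquiv_zsmul`), and `(flowEquiv τ)^p = 1` in characteristic `p` (`flowEquiv_pow_char`);
* **(Φ2)** (exact, no weights needed): `rescaleHom_flow_C_mul_X_pow` — conjugating by `σ ↦ cσ` turns `Ψ_{aσ^r}` into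
  `Ψ_{ac^rσ^r}`; `coeff_flowC_C_mul_X_pow` — the order-`r` datum of `Ψ_{aσ^r}` on `g` is `a·D g` (`1 ≤ r < p`);
  `flow_C_X_of_apply_eq_zero` — `Ψ_τ` fixes the `D`-constant generators; with `isGradedHom_flow` / `isTW_map_C_mul_X_pow`,
  `Ψ_{aσ^r}` is graded when `θ = r•ρ`.

CAUTION kept from the engine (RE-DERIVATION-eng1-g44 §0 row 3.12 (s′), machine-confirmed twice): the hypothesis is the WEIGHT bound,
not "`D^p = 0` on generators" — over `𝔽₅`, `Dz = 1, Dy = z², Df = y²` has `D⁵ = 0` on generators and the group law FAILS on `f`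
(`f` weighs `7θ ≥ 5θ`: not light).  Toy-model dictionary: `R = k`, `θ = r = w(L₁) ∈ [2, p-1]` (`wt σ = 1`), light weights `< p`,
`τ = σ^r`, `Φ_𝔇(σ^r) = flowEquiv (X ^ r) ∈ 𝔄_r` with `π_r = 𝔇` and `s_μ Φ_𝔇(σ^r) = Φ_𝔇(μ^r σ^r) = Φ_𝔇(σ^r)^N`, `N ≡ μ^r`.
Instrument for the toy model only; NOT a resolution theorem and NOT about the invariant of [ATW24].

References: Matsumura, *Commutative Ring Theory*, §27 (pp. 207–209) [Matsumura1987] — in characteristic `0`, `exp(tD)` of a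
locally nilpotent derivation is an automorphism and `t ↦ exp(tD)` a one-parameter group; the weight-bounded characteristic-free
version here (divided powers only below `p`) is derived in this file.  Abramovich–Temkin–Włodarczyk [ATW24, Thm. 5.3.1 (2)–(3)
(p. 1578)]: CONTEXT ONLY (graded coordinates).
-/

namespace Literature.AlgebraicGeometry.Resolution.WeightedBlowup

open Polynomial Finset
open scoped Nat

section NegativeWeight

variable {R : Type*} [CommRing R] {ι : Type*} {M : Type*} [AddCommGroup M] [LinearOrder M] [IsOrderedAddMonoid M]
  {w : ι → M}

/-- **The weight bound** (derived here): with nonnegative weights, a weighted-homogeneous polynomial of NEGATIVE weight is zero.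
[cite: AbramovichTemkinWlodarczyk2024, Thm. 5.3.1 (2)–(3) (p. 1578)] -/
theorem eq_zero_of_isWeightedHomogeneous_of_neg (hw : ∀ j, 0 ≤ w j) {a : MvPolynomial ι R} {m : M}
    (ha : MvPolynomial.IsWeightedHomogeneous w a m) (hm : m < 0) : a = 0 := by
  by_contra h0
  obtain ⟨d, hd⟩ := MvPolynomial.ne_zero_iff.mp h0
  have hwd : Finsupp.weight w d = m := ha hd
  have h0' : (0 : M) ≤ Finsupp.weight w d := by
    rw [Finsupp.weight_apply, Finsupp.sum]
    exact Finset.sum_nonneg fun i _ => nsmul_nonneg (hw i) _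
  exact absurd (h0'.trans_eq hwd) (not_le.mpr hm)

end NegativeWeight

namespace TruncatedFlow

section OrderDatum

variable {R : Type*} [CommRing R] {ι : Type*} (D : Derivation R (MvPolynomial ι R) (MvPolynomial ι R)) (p : ℕ) (u : ℕ → R)

/-- `Ψ_τ` FIXES the `D`-constant generators: `D ε_i = 0 ⇒ Ψ_τ ε_i = ε_i` for every `τ` (derived here; the fixed slots `V` of the
toy model). [cite: Matsumura1987, §27 (pp. 207–209)] -/
theorem flowC_X_of_apply_eq_zero (hu : ∀ k < p, (k ! : R) * u k = 1) (hp : 1 ≤ p) {i : ι} (hi : D (MvPolynomial.X i) = 0)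
    (τ : R[X]) : flowC D p u τ (MvPolynomial.X i) = C (MvPolynomial.X i) := by
  have hu0 : u 0 = 1 := by simpa using hu 0 (by omega)
  rw [flowC_X, Finset.sum_eq_single 0 (fun k _ hk => ?_) (fun h => absurd (mem_range.mpr (by omega)) h), pow_zero, mul_one,
    Function.iterate_zero, id_eq, hu0, one_smul]
  rw [derivation_iterate_eq_zero_of_le D (m := 1) (by simpa using hi) (Nat.one_le_iff_ne_zero.mpr hk), smul_zero, map_zero,
    zero_mul]

/-- (plumbing) `Ψ_τ (C ε_i) = C ε_i` for a `D`-constant generator. [cite: Matsumura1987, §27 (pp. 207–209)] -/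
theorem flow_C_X_of_apply_eq_zero (hu : ∀ k < p, (k ! : R) * u k = 1) (hp : 1 ≤ p) {i : ι} (hi : D (MvPolynomial.X i) = 0)
    (τ : R[X]) : flow D p u τ (C (MvPolynomial.X i)) = C (MvPolynomial.X i) := by
  rw [flow_C, flowC_X_of_apply_eq_zero D p u hu hp hi]

/-- (plumbing) rescaling a monomial parameter: `(σ ↦ cσ) (a σ^r) = a c^r σ^r`. [cite: SerreLocalFields1979, Ch. II §4 Lemma 1] -/
theorem sigmaScale_C_mul_X_pow (c a : R) (r : ℕ) : sigmaScale c (C a * X ^ r) = C (a * c ^ r) * X ^ r := by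
  rw [sigmaScale_apply, mul_comp, C_comp, pow_comp, X_comp, mul_pow, ← C_pow, map_mul, mul_assoc]

/-- **(Φ2), scaling** (derived here, exact, no weights needed): conjugating `Ψ_{aσ^r}` by `σ ↦ cσ` gives `Ψ_{ac^rσ^r}` — in the toy
model `s_μ Φ_𝔇(σ^r) = Φ_𝔇(μ^r σ^r)`. [cite: SerreLocalFields1979, Ch. II §4 Lemma 1] -/
theorem rescaleHom_flow_C_mul_X_pow (c a : R) (r : ℕ) :
    rescaleHom (MvPolynomial.C c) (flow D p u (C a * X ^ r)) = flow D p u (C (a * c ^ r) * X ^ r) := by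
  rw [rescaleHom_flow, sigmaScale_C_mul_X_pow]

/-- **The order-`r` datum of `Ψ_{aσ^r}` is `a·D`** (derived here; `1 ≤ r < p`, no weights needed): `coeff σ^r (Ψ_{aσ^r} g) = a·D g`
— in the toy model `π_r(Φ_𝔇(σ^r)) = 𝔇`. [cite: Matsumura1987, §27 (pp. 207–209)] -/
theorem coeff_flowC_C_mul_X_pow (hu : ∀ k < p, (k ! : R) * u k = 1) {r : ℕ} (hr : 1 ≤ r) (hrp : r < p) (a : R)
    (g : MvPolynomial ι R) : (flowC D p u (C a * X ^ r) g).coeff r = a • D g := by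
  have hu1 : u 1 = 1 := by simpa using hu 1 (by omega)
  have hτ : X ∣ C a * X ^ r := Dvd.intro_left (C a * X ^ (r - 1)) (by rw [mul_assoc, ← pow_succ, Nat.sub_add_cancel hr])
  obtain ⟨q, hq⟩ := X_pow_dvd_flowC_sub D p u hu hτ g
  have hcoeff : (flowC D p u (C a * X ^ r) g).coeff r
      = (∑ n ∈ range p, C (u n • D^[n] g) * ((C a * X ^ r).map MvPolynomial.C) ^ n).coeff r := by
    rw [← sub_eq_zero, ← coeff_sub, hq, coeff_X_pow_mul', if_neg (not_le.mpr hrp)]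
  rw [hcoeff, finsetSum_coeff, Finset.sum_eq_single 1 (fun n hn hn1 => ?_) (fun h => absurd (mem_range.mpr (by omega)) h)]
  · rw [pow_one, Polynomial.map_mul, map_C, Polynomial.map_pow, map_X, ← mul_assoc, ← map_mul, coeff_C_mul_X_pow, if_pos rfl,
      hu1, one_smul, Function.iterate_one, MvPolynomial.smul_eq_C_mul, mul_comm]
  · rw [Polynomial.map_mul, map_C, Polynomial.map_pow, map_X, mul_pow, ← map_pow, ← pow_mul, ← mul_assoc, ← map_mul,
      coeff_C_mul_X_pow, if_neg]
    intro h
    rcases Nat.eq_zero_or_pos n with rfl | hn0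
    · rw [mul_zero] at h; omega
    · have h2 : r * 2 ≤ r * n := Nat.mul_le_mul_left r (by omega)
      rw [← h] at h2
      omega

end OrderDatum

section Graded

variable {R : Type*} [CommRing R] {ι : Type*} (D : Derivation R (MvPolynomial ι R) (MvPolynomial ι R)) (p : ℕ) (u : ℕ → R)
  {M : Type*} [AddCommGroup M] {w : ι → M} {ρ θ : M}

/-- `T g` has total weight `m` for `wt σ = θ` (derived here; `T = Ψ_σ` on constants and `isGradedHom_flow`).
[cite: AbramovichTemkinWlodarczyk2024, Thm. 5.3.1 (2)–(3) (p. 1578)] -/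
theorem isTW_sigmaExp
    (hD : ∀ (a : MvPolynomial ι R) (m : M), MvPolynomial.IsWeightedHomogeneous w a m →
      MvPolynomial.IsWeightedHomogeneous w (D a) (m - θ))
    {g : MvPolynomial ι R} {m : M} (hg : MvPolynomial.IsWeightedHomogeneous w g m) : IsTW w θ m (sigmaExp D p u g) := by
  have h := (isGradedHom_flow D p u (ρ := θ) hD (τ := X) (by rw [Polynomial.map_X]; exact isTW_X)).isTW_map_C hg
  rwa [flow_C, flowC_X_eq] at h

/-- (plumbing for `isGradedHom_flow`) the parameter `aσ^r` has total weight `r•ρ` when `wt σ = ρ`.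
[cite: AbramovichTemkinWlodarczyk2024, Thm. 5.3.1 (2)–(3) (p. 1578)] -/
theorem isTW_map_C_mul_X_pow (a : R) (r : ℕ) : IsTW w ρ (r • ρ) ((C a * X ^ r).map (MvPolynomial.C (σ := ι))) := by
  rw [Polynomial.map_mul, map_C, Polynomial.map_pow, map_X]
  have h := (isTW_C (ρ := ρ) (MvPolynomial.isWeightedHomogeneous_C w a)).mul ((isTW_X (w := w) (ρ := ρ)).pow r)
  rwa [zero_add] at h

/-- **`Ψ_{aσ^r}` is graded** when `D` has degree `-(r•ρ)` (derived here; the toy model's `Φ_𝔇(σ^r) ∈ 𝔄` with `deg 𝔇 = -r`,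
`wt σ = 1`). [cite: AbramovichTemkinWlodarczyk2024, Thm. 5.3.1 (2)–(3) (p. 1578)] -/
theorem isGradedHom_flow_C_mul_X_pow {r : ℕ}
    (hD : ∀ (a : MvPolynomial ι R) (m : M), MvPolynomial.IsWeightedHomogeneous w a m →
      MvPolynomial.IsWeightedHomogeneous w (D a) (m - r • ρ)) (a : R) :
    IsGradedHom w ρ (flow D p u (C a * X ^ r)) :=
  isGradedHom_flow D p u hD (isTW_map_C_mul_X_pow a r)

end Graded

section WeightBounded

variable {R : Type*} [CommRing R] {ι : Type*} (D : Derivation R (MvPolynomial ι R) (MvPolynomial ι R)) (p : ℕ) (u : ℕ → R)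
  {M : Type*} [AddCommGroup M] [LinearOrder M] [IsOrderedAddMonoid M] {w : ι → M} {ρ θ : M}

/-- **Weight bound for the iterates** (derived here): if `D` lowers weights by `θ` and `g` is homogeneous of weight `m < n•θ`, then
`D^[n] g = 0`. [cite: Matsumura1987, §27 (pp. 207–209)] -/
theorem iterate_eq_zero_of_weight_lt (hw : ∀ j, 0 ≤ w j)
    (hD : ∀ (a : MvPolynomial ι R) (m : M), MvPolynomial.IsWeightedHomogeneous w a m →
      MvPolynomial.IsWeightedHomogeneous w (D a) (m - θ))
    {g : MvPolynomial ι R} {m : M} (hg : MvPolynomial.IsWeightedHomogeneous w g m) {n : ℕ} (hn : m < n • θ) :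
    D^[n] g = 0 :=
  eq_zero_of_isWeightedHomogeneous_of_neg hw (isWeightedHomogeneous_iterate D hD hg n) (sub_neg.mpr hn)

/-- **Weight bound for the carries** (derived here): `coeff σ^n (T g) = 0` once `m < n•θ` — in particular every
`σ^{≥p}`-coefficient of `T g` vanishes for LIGHT `g` (`m < p•θ`), with no nilpotency hypothesis. [cite: Matsumura1987, §27 (pp. 207–209)] -/
theorem coeff_sigmaExp_eq_zero_of_weight_lt (hw : ∀ j, 0 ≤ w j)
    (hD : ∀ (a : MvPolynomial ι R) (m : M), MvPolynomial.IsWeightedHomogeneous w a m →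
      MvPolynomial.IsWeightedHomogeneous w (D a) (m - θ))
    {g : MvPolynomial ι R} {m : M} (hg : MvPolynomial.IsWeightedHomogeneous w g m) {n : ℕ} (hn : m < n • θ) :
    (sigmaExp D p u g).coeff n = 0 :=
  eq_zero_of_isWeightedHomogeneous_of_neg hw (isTW_sigmaExp D p u hD hg n) (sub_neg.mpr hn)

/-- **Exact truncated sum for light constants** (derived here): if `g` is homogeneous of weight `m < p•θ` then for EVERY parameter
`τ ∈ R[σ]`, `Ψ_τ g = Σ_{n<p} u_n D^[n] g ⟪τ⟫^n` (no `σ^p`-error term). [cite: Matsumura1987, §27 (pp. 207–209)] -/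
theorem flowC_eq_sum_of_weight_lt (hu : ∀ k < p, (k ! : R) * u k = 1) (hw : ∀ j, 0 ≤ w j) (hθ : 0 ≤ θ)
    (hD : ∀ (a : MvPolynomial ι R) (m : M), MvPolynomial.IsWeightedHomogeneous w a m →
      MvPolynomial.IsWeightedHomogeneous w (D a) (m - θ))
    {g : MvPolynomial ι R} {m : M} (hg : MvPolynomial.IsWeightedHomogeneous w g m) (hm : m < p • θ) (τ : R[X]) :
    flowC D p u τ g = ∑ n ∈ range p, C (u n • D^[n] g) * (τ.map MvPolynomial.C) ^ n := by
  have hdeg : (sigmaExp D p u g).natDegree < p + ((sigmaExp D p u g).natDegree + 1) := by omega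
  rw [flowC_apply, aeval_eq_sum_range' hdeg, Finset.sum_range_add]
  have h1 : ∑ i ∈ range p, (sigmaExp D p u g).coeff i • (τ.map MvPolynomial.C) ^ i
      = ∑ n ∈ range p, C (u n • D^[n] g) * (τ.map MvPolynomial.C) ^ n :=
    Finset.sum_congr rfl fun i hi => by rw [smul_eq_C_mul, coeff_sigmaExp_of_lt D p u hu g (mem_range.mp hi)]
  have h2 : ∑ j ∈ range ((sigmaExp D p u g).natDegree + 1),
      (sigmaExp D p u g).coeff (p + j) • (τ.map (MvPolynomial.C (σ := ι))) ^ (p + j) = 0 :=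
    Finset.sum_eq_zero fun j _ => by
      rw [coeff_sigmaExp_eq_zero_of_weight_lt D p u hw hD hg (hm.trans_le ?_), zero_smul]
      rw [add_nsmul]
      exact le_add_of_nonneg_right (nsmul_nonneg hθ j)
  rw [h1, h2, add_zero]

/-- **(Φ1), core: EXACT group law on a light constant** (derived here): for `g` homogeneous of weight `m < p•θ` and all
`τ₁, τ₂ ∈ R[σ]`, `Ψ_{τ₁} (Ψ_{τ₂} g) = Ψ_{τ₁+τ₂} g`.  The two error terms of the truncated law vanish by weight:
`D^{j+k} g = 0` for `j + k ≥ p`, and `T (D^k g)` has no `σ^{≥p}`-coefficients. [cite: Matsumura1987, §27 (pp. 207–209)] -/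
theorem flow_flowC_eq_of_weight_lt (hu : ∀ k < p, (k ! : R) * u k = 1) (hw : ∀ j, 0 ≤ w j) (hθ : 0 ≤ θ)
    (hD : ∀ (a : MvPolynomial ι R) (m : M), MvPolynomial.IsWeightedHomogeneous w a m →
      MvPolynomial.IsWeightedHomogeneous w (D a) (m - θ))
    {g : MvPolynomial ι R} {m : M} (hg : MvPolynomial.IsWeightedHomogeneous w g m) (hm : m < p • θ) (τ₁ τ₂ : R[X]) :
    flow D p u τ₁ (flowC D p u τ₂ g) = flowC D p u (τ₁ + τ₂) g := by
  obtain ⟨f, hf⟩ : ∃ f : ℕ → ℕ → (MvPolynomial ι R)[X],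
      ∀ j k, f j k = C ((u j * u k) • D^[j + k] g) * (τ₁.map MvPolynomial.C) ^ j * (τ₂.map MvPolynomial.C) ^ k :=
    ⟨_, fun _ _ => rfl⟩
  have hgk : ∀ k, MvPolynomial.IsWeightedHomogeneous w (u k • D^[k] g) (m - k • θ) := fun k =>
    (MvPolynomial.weightedHomogeneousSubmodule R w _).smul_mem (u k) (isWeightedHomogeneous_iterate D hD hg k)
  have hmk : ∀ k : ℕ, m - k • θ < p • θ := fun k => (sub_le_self _ (nsmul_nonneg hθ k)).trans_lt hm
  -- (1)+(2): both applications of `Ψ` are exact truncated sums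
  have h12 : flow D p u τ₁ (flowC D p u τ₂ g) = ∑ k ∈ range p, ∑ j ∈ range p, f j k := by
    rw [flowC_eq_sum_of_weight_lt D p u hu hw hθ hD hg hm, map_sum]
    refine Finset.sum_congr rfl fun k _ => ?_
    rw [map_mul, map_pow, flow_C, flow_map, flowC_eq_sum_of_weight_lt D p u hu hw hθ hD (hgk k) (hmk k), Finset.sum_mul]
    exact Finset.sum_congr rfl fun j _ => by rw [hf, derivation_iterate_map_smul, smul_smul, Function.iterate_add_apply]
  -- (3): the terms with `j + k ≥ p` vanish (`D^[j+k] g` has negative weight)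
  have h3 : ∑ k ∈ range p, ∑ j ∈ range p, f j k = ∑ j ∈ range p, ∑ k ∈ range (p - j), f j k := by
    rw [Finset.sum_comm]
    refine Finset.sum_congr rfl fun j _ => ?_
    have hz : ∑ k ∈ Ico (p - j) p, f j k = 0 := Finset.sum_eq_zero fun k hk => by
      have hle : p ≤ j + k := by have := (Finset.mem_Ico.mp hk).1; omega
      rw [hf, iterate_eq_zero_of_weight_lt D hw hD hg (hm.trans_le (nsmul_le_nsmul_left hθ hle)), smul_zero, map_zero,
        zero_mul, zero_mul]
    rw [← Finset.sum_range_add_sum_Ico (fun k => f j k) (Nat.sub_le p j), hz, add_zero]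
  -- (4): binomial theorem, `u_s (s choose j) = u_j u_{s-j}` for `s < p`
  have hcast : ∀ n : ℕ, (n : (MvPolynomial ι R)[X]) = C (MvPolynomial.C (n : R)) := fun n => by rw [map_natCast, map_natCast]
  have h4 : ∑ j ∈ range p, ∑ k ∈ range (p - j), f j k
      = ∑ s ∈ range p, C (u s • D^[s] g) * ((τ₁.map MvPolynomial.C) + (τ₂.map MvPolynomial.C)) ^ s := by
    rw [← Finset.sum_range_diag_flip]
    refine Finset.sum_congr rfl fun s hs => ?_
    rw [add_pow, Finset.mul_sum]
    refine Finset.sum_congr rfl fun j hjs => ?_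
    have hs' : s < p := mem_range.mp hs
    have hjs' : j ≤ s := Nat.lt_succ_iff.mp (mem_range.mp hjs)
    have huj := inv_factorial_mul_choose (hu j (by omega)) (hu (s - j) (by omega))
      (by rw [Nat.add_sub_cancel' hjs']; exact hu s hs')
    rw [Nat.add_sub_cancel' hjs'] at huj
    rw [hf, Nat.add_sub_cancel' hjs', ← huj, hcast, ← smul_smul, MvPolynomial.smul_eq_C_mul _ ((s.choose j : ℕ) : R),
      ← mul_smul_comm, map_mul]
    ring
  -- (5): … which is `Ψ_{τ₁+τ₂} g`, again exactly
  rw [h12, h3, h4, ← Polynomial.map_add, flowC_eq_sum_of_weight_lt D p u hu hw hθ hD hg hm]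

/-- **(Φ1): `τ ↦ Ψ_τ` IS a one-parameter group** (derived here): if every generator is LIGHT or `D`-constant
(`w i < p•θ ∨ D ε_i = 0`; the `D`-constant ones may be heavy — the fixed slots `V`), then `Ψ_{τ₁} ∘ Ψ_{τ₂} = Ψ_{τ₁+τ₂}` as ring
endomorphisms of `A[σ]`, for ALL `τ₁, τ₂ ∈ R[σ]`. [cite: Matsumura1987, §27 (pp. 207–209)] -/
theorem flow_comp_flow (hu : ∀ k < p, (k ! : R) * u k = 1) (hp : 1 ≤ p) (hw : ∀ j, 0 ≤ w j) (hθ : 0 ≤ θ)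
    (hD : ∀ (a : MvPolynomial ι R) (m : M), MvPolynomial.IsWeightedHomogeneous w a m →
      MvPolynomial.IsWeightedHomogeneous w (D a) (m - θ))
    (hgen : ∀ i, w i < p • θ ∨ D (MvPolynomial.X i) = 0) (τ₁ τ₂ : R[X]) :
    (flow D p u τ₁).comp (flow D p u τ₂) = flow D p u (τ₁ + τ₂) := by
  have hX : ∀ i, flow D p u τ₁ (flowC D p u τ₂ (MvPolynomial.X i)) = flowC D p u (τ₁ + τ₂) (MvPolynomial.X i) := fun i => by
    rcases hgen i with hi | hi
    · exact flow_flowC_eq_of_weight_lt D p u hu hw hθ hD (MvPolynomial.isWeightedHomogeneous_X R w i) hi τ₁ τ₂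
    · rw [flowC_X_of_apply_eq_zero D p u hu hp hi, flowC_X_of_apply_eq_zero D p u hu hp hi, flow_C,
        flowC_X_of_apply_eq_zero D p u hu hp hi]
  refine Polynomial.ringHom_ext (fun a => ?_) (by rw [RingHom.comp_apply, flow_X, flow_X, flow_X])
  rw [RingHom.comp_apply, flow_C, flow_C]
  induction a using MvPolynomial.induction_on with
  | C r => rw [flowC_C, flowC_C, flow_C_C]
  | add a b ha hb => rw [map_add, map_add, map_add, ha, hb]
  | mul_X a i ha => rw [map_mul, map_mul, map_mul, ha, hX i]

/-- `Ψ_τ ∘ Ψ_{-τ} = id` (derived here). [cite: Matsumura1987, §27 (pp. 207–209)] -/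
theorem flow_comp_flow_neg (hu : ∀ k < p, (k ! : R) * u k = 1) (hp : 1 ≤ p) (hw : ∀ j, 0 ≤ w j) (hθ : 0 ≤ θ)
    (hD : ∀ (a : MvPolynomial ι R) (m : M), MvPolynomial.IsWeightedHomogeneous w a m →
      MvPolynomial.IsWeightedHomogeneous w (D a) (m - θ))
    (hgen : ∀ i, w i < p • θ ∨ D (MvPolynomial.X i) = 0) (τ : R[X]) :
    (flow D p u τ).comp (flow D p u (-τ)) = RingHom.id _ := by
  rw [flow_comp_flow D p u hu hp hw hθ hD hgen, add_neg_cancel, flow_zero D p u hu hp]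

/-- **`Ψ_τ` is a ring AUTOMORPHISM of `A[σ]`** with inverse `Ψ_{-τ}` (construction, derived here) — the toy model's
`Φ_𝔇(τ) ∈ Aut A[σ]`, an element of the ambient group of the order filtration. [cite: Matsumura1987, §27 (pp. 207–209)] -/
noncomputable def flowEquiv (hu : ∀ k < p, (k ! : R) * u k = 1) (hp : 1 ≤ p) (hw : ∀ j, 0 ≤ w j) (hθ : 0 ≤ θ)
    (hD : ∀ (a : MvPolynomial ι R) (m : M), MvPolynomial.IsWeightedHomogeneous w a m →
      MvPolynomial.IsWeightedHomogeneous w (D a) (m - θ))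
    (hgen : ∀ i, w i < p • θ ∨ D (MvPolynomial.X i) = 0) (τ : R[X]) :
    (MvPolynomial ι R)[X] ≃+* (MvPolynomial ι R)[X] :=
  RingEquiv.ofRingHom (flow D p u τ) (flow D p u (-τ)) (flow_comp_flow_neg D p u hu hp hw hθ hD hgen τ)
    (by simpa only [neg_neg] using flow_comp_flow_neg D p u hu hp hw hθ hD hgen (-τ))

variable {D p u}

section Equiv

variable (hu : ∀ k < p, (k ! : R) * u k = 1) (hp : 1 ≤ p) (hw : ∀ j, 0 ≤ w j) (hθ : 0 ≤ θ)
  (hD : ∀ (a : MvPolynomial ι R) (m : M), MvPolynomial.IsWeightedHomogeneous w a m →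
    MvPolynomial.IsWeightedHomogeneous w (D a) (m - θ))
  (hgen : ∀ i, w i < p • θ ∨ D (MvPolynomial.X i) = 0)
include hu hp hw hθ hD hgen

/-- (plumbing) `flowEquiv τ` acts as `Ψ_τ`. [cite: Matsumura1987, §27 (pp. 207–209)] -/
@[simp] theorem flowEquiv_apply (τ : R[X]) (y : (MvPolynomial ι R)[X]) :
    flowEquiv D p u hu hp hw hθ hD hgen τ y = flow D p u τ y := rfl

/-- (plumbing) the underlying ring hom of `flowEquiv τ` is `Ψ_τ`. [cite: Matsumura1987, §27 (pp. 207–209)] -/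
theorem toRingHom_flowEquiv (τ : R[X]) : (flowEquiv D p u hu hp hw hθ hD hgen τ : _ →+* _) = flow D p u τ :=
  RingHom.ext fun _ => rfl

/-- (plumbing) `(flowEquiv τ)⁻¹ = flowEquiv (-τ)`. [cite: Matsumura1987, §27 (pp. 207–209)] -/
theorem flowEquiv_symm_apply (τ : R[X]) (y : (MvPolynomial ι R)[X]) :
    (flowEquiv D p u hu hp hw hθ hD hgen τ).symm y = flow D p u (-τ) y := rfl

/-- `flowEquiv 0 = 1` (derived here). [cite: Matsumura1987, §27 (pp. 207–209)] -/
theorem flowEquiv_zero : flowEquiv D p u hu hp hw hθ hD hgen 0 = 1 :=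
  RingEquiv.ext fun y => by rw [flowEquiv_apply, flow_zero D p u hu hp]; rfl

/-- **The group law in `Aut A[σ]`** (derived here): `flowEquiv (τ₁ + τ₂) = flowEquiv τ₁ * flowEquiv τ₂`.
[cite: Matsumura1987, §27 (pp. 207–209)] -/
theorem flowEquiv_add (τ₁ τ₂ : R[X]) :
    flowEquiv D p u hu hp hw hθ hD hgen (τ₁ + τ₂) = flowEquiv D p u hu hp hw hθ hD hgen τ₁ * flowEquiv D p u hu hp hw hθ hD hgen τ₂ :=
  RingEquiv.ext fun y => by
    rw [RingAut.mul_apply, flowEquiv_apply, flowEquiv_apply, flowEquiv_apply, ← RingHom.comp_apply,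
      flow_comp_flow D p u hu hp hw hθ hD hgen]

/-- `flowEquiv (-τ) = (flowEquiv τ)⁻¹` (derived here). [cite: Matsumura1987, §27 (pp. 207–209)] -/
theorem flowEquiv_neg (τ : R[X]) : flowEquiv D p u hu hp hw hθ hD hgen (-τ) = (flowEquiv D p u hu hp hw hθ hD hgen τ)⁻¹ :=
  eq_inv_of_mul_eq_one_left (by rw [← flowEquiv_add, neg_add_cancel, flowEquiv_zero])

/-- **`τ ↦ Ψ_τ` as a group homomorphism `R[σ] → Aut A[σ]`** (construction, derived here). [cite: Matsumura1987, §27 (pp. 207–209)] -/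
noncomputable def flowHom : Multiplicative R[X] →* ((MvPolynomial ι R)[X] ≃+* (MvPolynomial ι R)[X]) where
  toFun τ := flowEquiv D p u hu hp hw hθ hD hgen τ.toAdd
  map_one' := flowEquiv_zero hu hp hw hθ hD hgen
  map_mul' _ _ := flowEquiv_add hu hp hw hθ hD hgen _ _

/-- (plumbing) [cite: Matsumura1987, §27 (pp. 207–209)] -/
theorem flowHom_ofAdd (τ : R[X]) :
    flowHom hu hp hw hθ hD hgen (Multiplicative.ofAdd τ) = flowEquiv D p u hu hp hw hθ hD hgen τ := rfl

/-- **Powers are multiples of the parameter**: `(flowEquiv τ)^N = flowEquiv (N•τ)` (derived here) — in the toy model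
`Φ_𝔇(τ)^N = Φ_𝔇(Nτ)`, so with (Φ2) `s_μ Φ_𝔇(σ^r) = Φ_𝔇(σ^r)^N` for `N ≡ μ^r`. [cite: Matsumura1987, §27 (pp. 207–209)] -/
theorem flowEquiv_nsmul (N : ℕ) (τ : R[X]) :
    flowEquiv D p u hu hp hw hθ hD hgen (N • τ) = flowEquiv D p u hu hp hw hθ hD hgen τ ^ N := by
  rw [← flowHom_ofAdd hu hp hw hθ hD hgen, ← flowHom_ofAdd hu hp hw hθ hD hgen, ofAdd_nsmul, map_pow]

/-- Integer powers: `(flowEquiv τ)^N = flowEquiv (N•τ)` for `N : ℤ` (derived here). [cite: Matsumura1987, §27 (pp. 207–209)] -/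
theorem flowEquiv_zsmul (N : ℤ) (τ : R[X]) :
    flowEquiv D p u hu hp hw hθ hD hgen (N • τ) = flowEquiv D p u hu hp hw hθ hD hgen τ ^ N := by
  rw [← flowHom_ofAdd hu hp hw hθ hD hgen, ← flowHom_ofAdd hu hp hw hθ hD hgen, ofAdd_zsmul, map_zpow]

/-- **Exponent `p`** (derived here): in characteristic `p`, `(flowEquiv τ)^p = 1` (`p•τ = 0`) — the layers of the order filtration
have exponent `p`. [cite: Matsumura1987, §27 (pp. 207–209)] -/
theorem flowEquiv_pow_char [CharP R p] (τ : R[X]) : flowEquiv D p u hu hp hw hθ hD hgen τ ^ p = 1 := by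
  rw [← flowEquiv_nsmul, nsmul_eq_mul, ← map_natCast (Polynomial.C : R →+* R[X]), CharP.cast_eq_zero R p, map_zero, zero_mul,
    flowEquiv_zero]

/-- `flowEquiv (aσ^r)` and its scaled parameter: `rescaleHom (C c) (flowEquiv (aσ^r)) = Ψ_{ac^rσ^r}` as ring homs ((Φ2), plumbing).
[cite: SerreLocalFields1979, Ch. II §4 Lemma 1] -/
theorem rescaleHom_flowEquiv_C_mul_X_pow (c a : R) (r : ℕ) :
    rescaleHom (MvPolynomial.C c) (flowEquiv D p u hu hp hw hθ hD hgen (C a * X ^ r) : _ →+* _)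
      = flow D p u (C (a * c ^ r) * X ^ r) := by
  rw [toRingHom_flowEquiv, rescaleHom_flow_C_mul_X_pow]

end Equiv

end WeightBounded

end TruncatedFlow

end Literature.AlgebraicGeometry.Resolution.WeightedBlowup
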